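import Mathlib.FieldTheory.KummerExtension
import Mathlib.NumberTheory.Real.Irrational
import Literature.NumberTheory.QuadraticFields.SquareRootGenerator
import Literature.NumberTheory.QuadraticFields.KroneckerSplitting
import Literature.NumberTheory.EllipticCurves.HeegnerPointsImaginaryQuadraticProofs
import HarnessLib

/-!
# Road (C) `disegni-pair-two` on crux stmt-BirchSwinnertonDyer-20368 — FRAME, field-theoretic pieces

LEAD `bsd-line-cf2-p1` g21, for the registered stub `stub_frame_two` of `Lines/disegni_pair_two.lean` (v3). The
frame's FIELD objects exist by name: for an imaginary quadratic Friedberg–Hoffstein field `K` with `2` split,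
* two distinct primes `𝔭 ≠ 𝔭′` of `𝓞 K` above `2` (`exists_two_primes_above_two`);
* `K/ℚ` is Galois (`isGalois_rat_of_isImaginaryQuadratic`);
* `u = √d_K ∈ K ∖ ℚ` and the conjugation `c ∈ Aut(K/ℚ)` with `c u = −u` (`exists_sqrt_discr`, `exists_algEquiv_neg_sqrt`);
* `2, −1, −2` are NOT squares in `K` when `d_K ≡ 1 (mod 8)` (`sq_ne_of_discr_mod_eight_eq_one`);
* the tower `H = K(√d*)`, a number field with `[H : K] = 2`, `t = √d* ∉ K` (`exists_quadraticExt_sqrt`, Kummer theory at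
  `n = 2`).
THEOREMS ONLY; no `sorry`; no new definitions. BSD is not proved by any of this; 20368 is not closed here.
-/

set_option linter.dupNamespace false

noncomputable section

open scoped Classical NumberField

open Polynomial Module NumberField IsDedekindDomain Literature.NumberTheory.EllipticCurves
  Literature.NumberTheory.QuadraticFields

namespace Summit.BirchSwinnertonDyer.BirchSwinnertonDyer.Theorems.PrintCf2.DisegniPairTwo

/-! ### §1 The quadratic tower `H = K(√a)` -/

/-- **Kummer theory at `n = 2`: the quadratic extension `K(√a)` exists as a number field.** For a number field `K`
and `a ∈ ℚ` that is not a square in `K`, there is a number field `H ⊇ K` with `[H : K] = 2` and `t ∈ H ∖ K` with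
`t² = a` (a splitting field of `X² − a`). [cite: SilvermanAEC2009, X.2 Prop. 2.4] -/
theorem exists_quadraticExt_sqrt (K : Type) [Field K] [NumberField K] (a : ℚ)
    (ha : ∀ b : K, b ^ 2 ≠ algebraMap ℚ K a) :
    ∃ (H : Type) (_ : Field H) (_ : NumberField H) (_ : Algebra K H),
      Module.finrank K H = 2 ∧ ∃ t : H, t ∉ Set.range (algebraMap K H) ∧ t ^ 2 = algebraMap ℚ H a := by
  let a' : K := algebraMap ℚ K a
  have hirr : Irreducible (X ^ 2 - C a') := X_pow_sub_C_irreducible_of_prime Nat.prime_two (fun b => ha b)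
  have hneg : IsPrimitiveRoot (-1 : K) 2 := IsPrimitiveRoot.neg_one 0 (by norm_num)
  have hζ : (primitiveRoots 2 K).Nonempty := ⟨-1, (mem_primitiveRoots two_pos).mpr hneg⟩
  let L := (X ^ 2 - C a').SplittingField
  haveI : FiniteDimensional K L := Polynomial.IsSplittingField.finiteDimensional L (X ^ 2 - C a')
  haveI : CharZero L := charZero_of_injective_algebraMap (algebraMap K L).injective
  haveI : FiniteDimensional ℚ L := Module.Finite.trans K L
  have hNF : NumberField L := @NumberField.mk L _ inferInstance inferInstance
  have ht := rootOfSplitsXPowSubC_pow (n := 2) a' L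
  set t : L := rootOfSplitsXPowSubC (NeZero.pos 2) a' L with ht_def
  have h2 : Module.finrank K L = 2 := finrank_of_isSplittingField_X_pow_sub_C hζ hirr L
  refine ⟨L, inferInstance, hNF, inferInstance, h2, t, ?_, ?_⟩
  · rintro ⟨b, hb⟩
    apply ha b
    apply (algebraMap K L).injective
    rw [map_pow, hb, ht]
  · rw [ht]
    exact (IsScalarTower.algebraMap_apply ℚ K L a).symm

/-! ### §2 Imaginary quadratic fields: Galois, `√d_K`, the conjugation, primes above `2`, non-squares -/

variable {K : Type} [Field K] [NumberField K]

/-- An imaginary quadratic field is Galois over `ℚ` (degree `2`, characteristic `0`). [folklore] -/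
theorem isGalois_rat_of_isImaginaryQuadratic (hK : IsImaginaryQuadratic K) : IsGalois ℚ K :=
  haveI : Algebra.IsQuadraticExtension ℚ K := { finrank_eq_two' := hK.1 }
  inferInstance

/-- **`u = √d_K ∈ K ∖ ℚ`** for an imaginary quadratic field `K` (`K = ℚ(√d_K)`, `d_K < 0`). [folklore] -/
theorem exists_sqrt_discr (hK : IsImaginaryQuadratic K) :
    ∃ u : K, u ∉ Set.range (algebraMap ℚ K) ∧ u ^ 2 = algebraMap ℚ K (NumberField.discr K : ℚ) := by
  obtain ⟨-, -, δ, -, hδ⟩ := Quadratic.exists_sq_eq_discr (K := K) hK.1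
  have hneg : NumberField.discr K < 0 := hK.discr_neg
  have h1 : ((δ : K)) ^ 2 = (NumberField.discr K : K) := by
    have := congrArg ((↑) : 𝓞 K → K) hδ
    push_cast at this
    exact this
  refine ⟨(δ : K), ?_, ?_⟩
  · rintro ⟨q, hq⟩
    have hsq : (q : ℚ) ^ 2 = (NumberField.discr K : ℚ) := by
      apply (algebraMap ℚ K).injective
      rw [map_pow, hq, h1, map_intCast]
    have : (0 : ℚ) ≤ (NumberField.discr K : ℚ) := hsq ▸ sq_nonneg _
    exact absurd (by exact_mod_cast this : (0 : ℤ) ≤ NumberField.discr K) (not_le.mpr hneg)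
  · rw [h1, map_intCast]

/-- **The conjugation of `K = ℚ(u)`**: an automorphism `c ∈ Aut(K/ℚ)` with `c u = −u` (`u ∉ ℚ`, `u² ∈ ℚ`). [folklore] -/
theorem exists_algEquiv_neg_sqrt (h2 : Module.finrank ℚ K = 2) {u : K} {e : ℚ}
    (hu : u ∉ Set.range (algebraMap ℚ K)) (hue : u ^ 2 = algebraMap ℚ K e) :
    ∃ c : K ≃ₐ[ℚ] K, c u = -u := by
  let σ : K →ₐ[ℚ] K := Quadratic.conj h2 hu hue
  have hσσ : σ.comp σ = AlgHom.id ℚ K := AlgHom.ext fun x => Quadratic.conj_conj h2 hu hue x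
  exact ⟨AlgEquiv.ofAlgHom σ σ hσσ hσσ, Quadratic.conj_gen h2 hu hue⟩

/-- **Two distinct primes above a split prime.** If `(p)` has exactly two prime factors in `𝓞 K` then there are
`𝔭 ≠ 𝔭′` in the height-one spectrum with `p ∈ 𝔭`, `p ∈ 𝔭′`. [folklore] -/
theorem exists_two_primes_above {p : ℕ} (hp : p.Prime)
    (hsplit : ((Ideal.span {(p : ℤ)}).primesOver (𝓞 K)).ncard = 2) :
    ∃ 𝔭 𝔭' : HeightOneSpectrum (𝓞 K), ((p : ℕ) : 𝓞 K) ∈ 𝔭.asIdeal ∧ ((p : ℕ) : 𝓞 K) ∈ 𝔭'.asIdeal ∧ 𝔭 ≠ 𝔭' := by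
  obtain ⟨P, Q, hPQ, hset⟩ := Set.ncard_eq_two.mp hsplit
  have key : ∀ R ∈ ({P, Q} : Set (Ideal (𝓞 K))),
      ∃ v : HeightOneSpectrum (𝓞 K), v.asIdeal = R ∧ ((p : ℕ) : 𝓞 K) ∈ v.asIdeal := by
    intro R hR
    have hR' : R ∈ (Ideal.span {(p : ℤ)}).primesOver (𝓞 K) := by rw [hset]; exact hR
    obtain ⟨hRprime, hRover⟩ := hR'
    have hpR : ((p : ℕ) : 𝓞 K) ∈ R := by
      have : (algebraMap ℤ (𝓞 K)) (p : ℤ) ∈ R := by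
        rw [← Ideal.mem_comap, ← Ideal.under_def, ← hRover.over]
        exact Ideal.subset_span rfl
      rwa [map_natCast] at this
    have hRne : R ≠ ⊥ := by
      intro hb
      rw [hb, Ideal.mem_bot] at hpR
      exact (Nat.cast_ne_zero.mpr hp.ne_zero) hpR
    exact ⟨⟨R, hRprime, hRne⟩, rfl, hpR⟩
  obtain ⟨v, hv, hpv⟩ := key P (by simp)
  obtain ⟨w, hw, hpw⟩ := key Q (by simp)
  exact ⟨v, w, hpv, hpw, fun h => hPQ (by rw [← hv, ← hw, h])⟩

/-- `2` splits in `K` iff `d_K ≡ 1 (mod 8)` — the numerical form used by the frame (tree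
`Quadratic.ncard_primesOver_two_eq_two_iff`). [folklore] -/
theorem discr_mod_eight_eq_one_of_split (h2 : Module.finrank ℚ K = 2)
    (hsplit : ((Ideal.span {(2 : ℤ)}).primesOver (𝓞 K)).ncard = 2) : NumberField.discr K % 8 = 1 :=
  (Quadratic.ncard_primesOver_two_eq_two_iff h2).mp hsplit

/-- In a quadratic field no RATIONAL number squares to `2`, `−1` or `−2`. [folklore] -/
theorem rat_sq_ne_of_mem (q : ℚ) {a : ℚ} (ha : a = 2 ∨ a = -1 ∨ a = -2) : q ^ 2 ≠ a := by
  rcases ha with rfl | rfl | rfl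
  · intro h
    have hsq : IsSquare ((2 : ℕ) : ℚ) := ⟨q, by push_cast; rw [← h]; ring⟩
    rw [Rat.isSquare_natCast_iff] at hsq
    exact (irrational_sqrt_natCast_iff.mp Nat.prime_two.irrational_sqrt) hsq
  · nlinarith [sq_nonneg q]
  · nlinarith [sq_nonneg q]

/-- **`2`, `−1`, `−2` are not squares in an imaginary quadratic field in which `2` splits** (`d_K ≡ 1 (mod 8)`): if
`θ² = a` with `θ ∉ ℚ` then `d_K = a·q²` up to the square of `u·θ`, and `d_K < 0`, `d_K` odd exclude the three values.
[cite: SilvermanAEC2009, X.2 Prop. 2.4] -/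
theorem sq_ne_of_discr_mod_eight_eq_one (hK : IsImaginaryQuadratic K) (h8 : NumberField.discr K % 8 = 1)
    {a : ℚ} (ha : a = 2 ∨ a = -1 ∨ a = -2) (b : K) : b ^ 2 ≠ algebraMap ℚ K a := by
  intro hb
  have h2 := hK.1
  have hneg : NumberField.discr K < 0 := hK.discr_neg
  by_cases hbQ : b ∈ Set.range (algebraMap ℚ K)
  · obtain ⟨q, rfl⟩ := hbQ
    rw [← map_pow] at hb
    exact rat_sq_ne_of_mem q ha ((algebraMap ℚ K).injective hb)
  -- `b ∉ ℚ`, `b² = a`: `d_K = a q²`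
  obtain ⟨q, hq0, hdq⟩ := NumberField.exists_discr_eq_mul_sq h2 hbQ hb
  rcases ha with rfl | rfl | rfl
  · -- `d_K = 2 q² ≥ 0`
    have : (0 : ℚ) ≤ (NumberField.discr K : ℚ) := by rw [hdq]; positivity
    exact absurd (by exact_mod_cast this : (0 : ℤ) ≤ NumberField.discr K) (not_le.mpr hneg)
  · -- `d_K = −q²`: then `(u b)² = −d_K` with `u = √d_K`; read `d_K·den² = −num²` mod 8
    have hZ : (NumberField.discr K : ℚ) * (q.den : ℚ) ^ 2 = -(q.num : ℚ) ^ 2 := by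
      rw [hdq]
      have hqd : q * q.den = q.num := Rat.mul_den_eq_num q
      linear_combination -(q * q.den + q.num) * hqd
    have hZ' : NumberField.discr K * (q.den : ℤ) ^ 2 = -q.num ^ 2 := by exact_mod_cast hZ
    have hcop : q.num.natAbs.Coprime q.den := q.reduced
    -- parity bookkeeping
    rcases Int.even_or_odd' (q.den : ℤ) with ⟨s, hs | hs⟩ <;> rcases Int.even_or_odd' q.num with ⟨r, hr | hr⟩
    · -- both even: contradicts coprimality
      have h2n : 2 ∣ q.num.natAbs := by
        rw [hr]; simp [Int.natAbs_mul]
      have h2d : 2 ∣ q.den := by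
        have : (2 : ℤ) ∣ (q.den : ℤ) := ⟨s, hs⟩
        exact_mod_cast this
      have := Nat.eq_one_of_dvd_coprimes hcop h2n h2d
      norm_num at this
    · rw [hs, hr] at hZ'
      have e1 : NumberField.discr K * (2 * s) ^ 2 = 4 * (NumberField.discr K * (s * s)) := by ring
      have e2 : -(2 * r + 1) ^ 2 = -(4 * (r * (r + 1)) + 1) := by ring
      rw [e1, e2] at hZ'
      omega
    · rw [hs, hr] at hZ'
      have e1 : NumberField.discr K * (2 * s + 1) ^ 2 = NumberField.discr K + 4 * (NumberField.discr K * (s * (s + 1))) := by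
        ring
      have e2 : -(2 * r) ^ 2 = -(4 * (r * r)) := by ring
      rw [e1, e2] at hZ'
      obtain ⟨w, hw⟩ := Int.even_mul_succ_self s
      rw [hw] at hZ'
      omega
    · rw [hs, hr] at hZ'
      have e1 : NumberField.discr K * (2 * s + 1) ^ 2 = NumberField.discr K + 4 * (NumberField.discr K * (s * (s + 1))) := by
        ring
      have e2 : -(2 * r + 1) ^ 2 = -(4 * (r * (r + 1)) + 1) := by ring
      rw [e1, e2] at hZ'
      obtain ⟨w, hw⟩ := Int.even_mul_succ_self s
      obtain ⟨w', hw'⟩ := Int.even_mul_succ_self r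
      rw [hw, hw'] at hZ'
      omega
  · -- `d_K = −2 q²`: `d_K·den² = −2·num²`; parity
    have hZ : (NumberField.discr K : ℚ) * (q.den : ℚ) ^ 2 = -2 * (q.num : ℚ) ^ 2 := by
      rw [hdq]
      have hqd : q * q.den = q.num := Rat.mul_den_eq_num q
      linear_combination -2 * (q * q.den + q.num) * hqd
    have hZ' : NumberField.discr K * (q.den : ℤ) ^ 2 = -2 * q.num ^ 2 := by exact_mod_cast hZ
    have hcop : q.num.natAbs.Coprime q.den := q.reduced
    rcases Int.even_or_odd' (q.den : ℤ) with ⟨s, hs | hs⟩ <;> rcases Int.even_or_odd' q.num with ⟨r, hr | hr⟩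
    · have h2n : 2 ∣ q.num.natAbs := by
        rw [hr]; simp [Int.natAbs_mul]
      have h2d : 2 ∣ q.den := by
        have : (2 : ℤ) ∣ (q.den : ℤ) := ⟨s, hs⟩
        exact_mod_cast this
      have := Nat.eq_one_of_dvd_coprimes hcop h2n h2d
      norm_num at this
    · rw [hs, hr] at hZ'
      have e1 : NumberField.discr K * (2 * s) ^ 2 = 4 * (NumberField.discr K * (s * s)) := by ring
      have e2 : -2 * (2 * r + 1) ^ 2 = -(8 * (r * (r + 1)) + 2) := by ring
      rw [e1, e2] at hZ'
      omega
    · rw [hs, hr] at hZ'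
      have e1 : NumberField.discr K * (2 * s + 1) ^ 2 = NumberField.discr K + 4 * (NumberField.discr K * (s * (s + 1))) := by
        ring
      have e2 : -2 * (2 * r) ^ 2 = -(8 * (r * r)) := by ring
      rw [e1, e2] at hZ'
      obtain ⟨w, hw⟩ := Int.even_mul_succ_self s
      rw [hw] at hZ'
      omega
    · rw [hs, hr] at hZ'
      have e1 : NumberField.discr K * (2 * s + 1) ^ 2 = NumberField.discr K + 4 * (NumberField.discr K * (s * (s + 1))) := by
        ring
      have e2 : -2 * (2 * r + 1) ^ 2 = -(8 * (r * (r + 1)) + 2) := by ring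
      rw [e1, e2] at hZ'
      obtain ⟨w, hw⟩ := Int.even_mul_succ_self s
      rw [hw] at hZ'
      omega

/-- **The tower of the frame**: for an imaginary quadratic `K` with `2` split and `d* ∈ {2, −1, −2}` there is a number
field `H ⊇ K`, `[H : K] = 2`, with `t ∈ H ∖ K`, `t² = d*`. [cite: Disegni2017, §1.1.1 (arXiv v3 PDF p. 3 L32–40)] -/
theorem exists_tower_sqrt (hK : IsImaginaryQuadratic K)
    (hsplit : ((Ideal.span {(2 : ℤ)}).primesOver (𝓞 K)).ncard = 2) {a : ℚ} (ha : a = 2 ∨ a = -1 ∨ a = -2) :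
    ∃ (H : Type) (_ : Field H) (_ : NumberField H) (_ : Algebra K H),
      Module.finrank K H = 2 ∧ ∃ t : H, t ∉ Set.range (algebraMap K H) ∧ t ^ 2 = algebraMap ℚ H a :=
  exists_quadraticExt_sqrt K a
    (sq_ne_of_discr_mod_eight_eq_one hK (discr_mod_eight_eq_one_of_split hK.1 hsplit) ha)

end Summit.BirchSwinnertonDyer.BirchSwinnertonDyer.Theorems.PrintCf2.DisegniPairTwo

end
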